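import Literature.IUT.LogThetaLattice.VerticallyCoricLGP
import Mathlib.Algebra.Module.Submodule.Lattice
import Mathlib.Algebra.Group.Nat.Hom
import Mathlib.Tactic.NormNum
import HarnessLib

/-!
# [IUTchIII] Proposition 3.5 (ii): the typed clauses (a), (b), (c) and the log-Kummer correspondence are SCHEMAS — universal-closure certificates (proofs only)

S. Mochizuki, *Inter-universal Teichmüller theory III*, kurims manuscript (May 2020), §3, Proposition 3.5 "(Kummer Theory
and Upper Semi-compatibility for Vertically Coric Local LGP-Monoids)" (ii) (a)–(c) and its final paragraph, pp. 104–106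
[claim: Mochizuki2012, status: disputed] (D-0012 claim key; the content proved here is elementary). abc-iut cell, block F
(seat abc-iut-f-130 gen 7; director-abc g4 row supply `ROWS-LF-0348.tsv` «decide the label»); frozen FACT-LIST rows
**F-2132** `Prop35ii_a`, **F-2133** `Prop35ii_b`, **F-2134** `Prop35ii_c`, **F-2136** `logKummerCorrespondence'` (abc-iut-L6-t4,
`VerticallyCoricLGP.lean`), node **IUTchIII:Prop3.5(ii)**. PROOF-ONLY (no `def`, no `instance`; nothing re-typed); pattern of
abc-iut-w5-d230's `GlobalPacketsLGPProp33iiSchemaClosures.lean`.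

All four predicates are typed over ABSTRACT data (a free ambient `X` / ring `R`, a free "log-shell" `I` / `I^ℚ`, free unit
groups / monoids with free Kummer maps `κ` and log-maps `λ`). Hence their universal closures are FALSE, and the rows are
consumable only in INSTANCE FORM at genuine carriers, where the tree holds the theorems (`prop35ii_a_ofUnitLog`,
`VerticallyCoricLGPNonarch.lean`; `prop35ii_b_archHermitian`, `VerticallyCoricLGPArchHermitian.lean`; `prop35ii_c_splittingMonoidAt`,
`logKummerCorrespondence'_splittingMonoidAt`, `VerticallyCoricLGPBad.lean`). The refutations fill the free slots degenerately:

* F-2132 — `not_forall_prop35ii_a`: the EMPTY log-shell `I := ∅` contains no Kummer image; `exists_prop35ii_a`: `I := univ`.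
* F-2133 — `not_forall_prop35ii_b`: idem (`κ '' univ ⊄ ∅`); `exists_prop35ii_b`: `I := univ`, `U = B := ∅`.
* F-2134 — `not_forall_prop35ii_c`: over `R = ℤ` with Kummer maps `n ↦ 2ⁿ` on `Multiplicative ℕ` and the total relation, the
  root-of-unity clause would need `2 = ζ · 1` with `ζᵏ = 1` in `ℤ`; `exists_prop35ii_c`: trivial monoids, `I^ℚ := ⊤`.
* F-2136 — `not_forall_logKummerCorrespondence'`: Kummer maps `n ↦ 1ⁿ` at `m = 0` and `n ↦ 2ⁿ` at `m ≠ 0` have different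
  ranges; `exists_logKummerCorrespondence'`: constant trivial Kummer maps, `I^ℚ := ⊤`.

HONEST FRAMING: a refuted universal closure is a statement about OUR typing (the predicates admit degenerate arguments), not
about the printed proposition, which concerns the genuine log-shells, unit groups and splitting monoids of the
`𝓕`-prime-strips — where the cited instance-form theorems apply. Nothing here bears on [IUTchIII] Cor. 3.12 or takes a side
on any author; typed ≠ proved; nothing asserts abc proved or refuted.
-/

noncomputable section

namespace Literature.IUT.LogThetaLattice

/-! ## F-2132 `Prop35ii_a` ([IUTchIII] Prop 3.5 (ii) (a), nonarchimedean primes) -/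

/-- **F-2132 is a schema**: with the free log-shell slot filled by `I := ∅`, the first clause (the Kummer image of a unit
lies in `I`) fails. Instance form of record: `prop35ii_a_ofUnitLog`.
[claim: Mochizuki2012, status: disputed] (IUTchIII §3 Prop 3.5 (ii)(a), kurims p.104) -/
theorem not_forall_prop35ii_a :
    ¬ ∀ (X : Type) (I : Set X) (U : ℤ → Type) (κ : ∀ m, U m → X)
        (lam : ∀ m (m' : ℕ), 1 ≤ m' → U m → Option X), Prop35ii_a I U κ lam := by
  intro h
  exact Set.notMem_empty _
    ((h Unit ∅ (fun _ => Unit) (fun _ _ => ()) (fun _ _ _ _ => none)).1 0 ())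

/-- **F-2132, INHABITED**: with `I := univ` both clauses hold.
[claim: Mochizuki2012, status: disputed] (IUTchIII §3 Prop 3.5 (ii)(a), kurims p.104) -/
theorem exists_prop35ii_a :
    ∃ (X : Type) (I : Set X) (U : ℤ → Type) (κ : ∀ m, U m → X)
        (lam : ∀ m (m' : ℕ), 1 ≤ m' → U m → Option X), Prop35ii_a I U κ lam :=
  ⟨Unit, Set.univ, fun _ => Unit, fun _ _ => (), fun _ _ _ _ => none,
    fun _ _ => Set.mem_univ _, fun _ _ _ _ _ _ => Set.mem_univ _⟩

/-! ## F-2133 `Prop35ii_b` ([IUTchIII] Prop 3.5 (ii) (b), archimedean primes) -/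

/-- **F-2133 is a schema**: with `I := ∅` and the unit groups `U m := univ` (nonempty), the first clause `κ '' U ⊆ I`
fails. Instance form of record: `prop35ii_b_archHermitian`.
[claim: Mochizuki2012, status: disputed] (IUTchIII §3 Prop 3.5 (ii)(b), kurims p.105) -/
theorem not_forall_prop35ii_b :
    ¬ ∀ (X : Type) (I : Set X) (G : ℤ → Type) (U B : ∀ m, Set (G m)) (κ : ∀ m, G m → X)
        (lam : ∀ m (m' : ℕ), G m → Option (G (m - m'))) (Dom : ∀ m (m' : ℕ), Set (G m)),
        Prop35ii_b I G U B κ lam Dom := by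
  intro h
  have h1 := (h Unit ∅ (fun _ => Unit) (fun _ => Set.univ) (fun _ => Set.univ) (fun _ _ => ())
    (fun _ _ _ => none) (fun _ _ => Set.univ)).1 0
  exact Set.notMem_empty _ (h1 ⟨(), Set.mem_univ _, rfl⟩)

/-- **F-2133, INHABITED**: with `I := univ` and `U = B := ∅` all three clauses hold (the third with `S := ∅`).
[claim: Mochizuki2012, status: disputed] (IUTchIII §3 Prop 3.5 (ii)(b), kurims p.105) -/
theorem exists_prop35ii_b :
    ∃ (X : Type) (I : Set X) (G : ℤ → Type) (U B : ∀ m, Set (G m)) (κ : ∀ m, G m → X)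
        (lam : ∀ m (m' : ℕ), G m → Option (G (m - m'))) (Dom : ∀ m (m' : ℕ), Set (G m)),
        Prop35ii_b I G U B κ lam Dom := by
  refine ⟨Unit, Set.univ, fun _ => Unit, fun _ => ∅, fun _ => ∅, fun _ _ => (), fun _ _ _ => none,
    fun _ _ => ∅, fun _ => by simp, fun _ => by simp, fun m m' _ => ⟨∅, le_rfl, ?_⟩⟩
  ext y
  simp

/-! ## F-2134 `Prop35ii_c` ([IUTchIII] Prop 3.5 (ii) (c), bad primes) -/

/-- **F-2134 is a schema**: over `R = ℤ`, `I^ℚ := ⊤`, monoids `Multiplicative ℕ` with Kummer maps `n ↦ 2ⁿ` at every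
`m` and the total relation, the root-of-unity clause fails at `x = 1`, `y = ofAdd 1`: `2 = ζ · 1` forces `ζ = 2`, and
`2ᵏ = 1` with `0 < k` is false. Instance form of record: `prop35ii_c_splittingMonoidAt`.
[claim: Mochizuki2012, status: disputed] (IUTchIII §3 Prop 3.5 (ii)(c), kurims pp.105–106) -/
theorem not_forall_prop35ii_c :
    ¬ ∀ (R : Type) [CommRing R] (IQ : Submodule ℤ R) (M : ℤ → Type) [∀ m, Monoid (M m)]
        (κ : ∀ m, M m →* R) (Rel : ∀ m, M m → M (m + 1) → Prop), Prop35ii_c IQ M κ Rel := by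
  intro h
  have h2 := (h ℤ ⊤ (fun _ => Multiplicative ℕ) (fun _ => powersHom ℤ 2) (fun _ _ _ => True)).2
    0 1 (Multiplicative.ofAdd 1) trivial
  obtain ⟨ζ, ⟨k, hk, hζk⟩, hζ⟩ := h2
  simp only [powersHom_apply, toAdd_ofAdd, toAdd_one, pow_one, pow_zero, mul_one] at hζ
  -- hζ : 2 = ζ
  rw [← hζ] at hζk
  have h2k : (2 : ℤ) ^ 1 ≤ 2 ^ k := pow_le_pow_right₀ (by norm_num) hk
  rw [pow_one, hζk] at h2k
  norm_num at h2k

/-- **F-2134, INHABITED**: trivial monoids with trivial Kummer maps into `ℤ`, `I^ℚ := ⊤`, any relation (`ζ := 1`).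
[claim: Mochizuki2012, status: disputed] (IUTchIII §3 Prop 3.5 (ii)(c), kurims pp.105–106) -/
theorem exists_prop35ii_c :
    ∃ (R : Type) (_ : CommRing R) (IQ : Submodule ℤ R) (M : ℤ → Type) (_ : ∀ m, Monoid (M m))
        (κ : ∀ m, M m →* R) (Rel : ∀ m, M m → M (m + 1) → Prop), Prop35ii_c IQ M κ Rel :=
  ⟨ℤ, inferInstance, ⊤, fun _ => Unit, fun _ => inferInstanceAs (Monoid Unit), fun _ => 1, fun _ _ _ => True,
    fun _ _ _ _ => Submodule.mem_top, fun _ _ _ _ => ⟨1, ⟨1, one_pos, one_pow 1⟩, by simp⟩⟩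

/-! ## F-2136 `logKummerCorrespondence'` ([IUTchIII] Prop 3.5 (ii), final paragraph, per-index form) -/

/-- **F-2136 is a schema**: over `R = ℤ`, `I^ℚ := ⊤`, monoids `Multiplicative ℕ` with Kummer maps `n ↦ 1ⁿ` at `m = 0` and
`n ↦ 2ⁿ` at `m ≠ 0`, the ranges at `m = 0` (`= {1}`) and `m = 1` (`∋ 2`) differ. Instance form of record:
`logKummerCorrespondence'_splittingMonoidAt`. [claim: Mochizuki2012, status: disputed] (IUTchIII §3 Prop 3.5 (ii), kurims p.106) -/
theorem not_forall_logKummerCorrespondence' :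
    ¬ ∀ (R : Type) [CommRing R] (IQ : Submodule ℤ R) (M : ℤ → Type) [∀ m, Monoid (M m)]
        (κ : ∀ m, M m →* R), logKummerCorrespondence' IQ M κ := by
  intro h
  have h2 := (h ℤ ⊤ (fun _ => Multiplicative ℕ) (fun m => powersHom ℤ (if m = 0 then 1 else 2))).2 0
  simp only [if_true, zero_add, one_ne_zero, if_false] at h2
  have hmem : (2 : ℤ) ∈ Set.range (powersHom ℤ (2 : ℤ)) :=
    ⟨Multiplicative.ofAdd 1, by rw [powersHom_apply, toAdd_ofAdd, pow_one]⟩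
  rw [← h2] at hmem
  obtain ⟨n, hn⟩ := hmem
  rw [powersHom_apply, one_pow] at hn
  norm_num at hn

/-- **F-2136, INHABITED**: constant trivial Kummer maps have equal ranges at consecutive indices; `I^ℚ := ⊤`.
[claim: Mochizuki2012, status: disputed] (IUTchIII §3 Prop 3.5 (ii), kurims p.106) -/
theorem exists_logKummerCorrespondence' :
    ∃ (R : Type) (_ : CommRing R) (IQ : Submodule ℤ R) (M : ℤ → Type) (_ : ∀ m, Monoid (M m))
        (κ : ∀ m, M m →* R), logKummerCorrespondence' IQ M κ :=
  ⟨ℤ, inferInstance, ⊤, fun _ => Unit, fun _ => inferInstanceAs (Monoid Unit), fun _ => 1,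
    fun _ _ _ _ => Submodule.mem_top, fun _ => rfl⟩

end Literature.IUT.LogThetaLattice

end
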